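import Summits.QuantumFields.YangMills.Theorems.FemtoTransferGapRungW1up
import Summits.QuantumFields.YangMills.Theorems.LuscherReductionOneSiteLevelsMagnetic

/-!
# The one-site Wilson action is link-Lipschitz: `|S(U) − S(V)| ≤ 24 · Σ_e ‖U_e − V_e‖_F`
# (support module for the registered stub `stub_absUpperOuter` / the VALLEY re-cut of crux `OneSiteLevels`, route `LuscherReduction`,
# item stmt-QuantumFields-20007; fleet lead prover ym-luscher-20007-p1)

The OUTER seam `absUpperOuter_of_valley` (`Theorems/LuscherReductionOneSiteLevelsOuterSeam.lean`) localises along ANY measurable, gauge- and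
twist-invariant, LINK-LIPSCHITZ magnetic phase `Φ_B`.  The natural choice is a ramp of the magnetic energy itself, `Φ_B = (π/2)·clamp01(S/η_B − 1)`;
its link-Lipschitz constant is `(π/2)·Lip(S)/η_B`.  This module supplies `Lip(S)`: the commutator holonomy is 2-Lipschitz in each factor in the
Frobenius norm (`frobNorm_comm_sub_comm_le`: telescoping with unitary invariance of `‖·‖_F` and `‖A⁻¹ − A′⁻¹‖_F = ‖A − A′‖_F`), the plaquette cost
`2 − Re tr[·,·]` is `4`-Lipschitz (`abs_plaquetteCost_sub_le`, `|Re tr X| ≤ 2‖X‖_F` for `2×2`), hence (`abs_wilsonAction_sub_le`)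
`|S(U) − S(V)| ≤ 24 Σ_e ‖U_e − V_e‖_F` at `L = 1` (each of the three plaquettes bounded by twice the full edge sum).  Also: `S` is twist-invariant
(`wilsonAction_twist`, central factors cancel in commutators) and gauge-invariant (tree `wilsonAction_gaugeTransform`).

## WHAT THIS IS NOT
No phase is constructed here and no valley analysis; NOT the crux, NOT THE CLAY GAP.  Sorry-free; no new definition, no named fact.
-/

set_option autoImplicit false

noncomputable section

open MeasureTheory Filter Topology Real
open scoped Matrix ComplexConjugate BigOperators
open Literature.MathematicalPhysics.QuantumFieldTheory
open Literature.MathematicalPhysics.QuantumLattice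

namespace Summit.QuantumFields.YangMills.Theorems.FemtoTransferGap

/-! ### §1. Frobenius-Lipschitz estimates for unitary words -/

/-- `|Re tr X| ≤ 2 ‖X‖_F` for a `2 × 2` complex matrix (each diagonal entry is bounded by the Frobenius norm). [folklore] -/
theorem abs_re_trace_le_two_mul_frobNorm (X : Matrix (Fin 2) (Fin 2) ℂ) : |X.trace.re| ≤ 2 * frobNorm X := by
  rw [Matrix.trace_fin_two, Complex.add_re]
  have h0 := norm_entry_le_frobNorm X 0 0
  have h1 := norm_entry_le_frobNorm X 1 1
  have r0 : |(X 0 0).re| ≤ ‖X 0 0‖ := Complex.abs_re_le_norm _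
  have r1 : |(X 1 1).re| ≤ ‖X 1 1‖ := Complex.abs_re_le_norm _
  calc |(X 0 0).re + (X 1 1).re| ≤ |(X 0 0).re| + |(X 1 1).re| := abs_add_le _ _
    _ ≤ 2 * frobNorm X := by linarith

/-- `‖A⁻¹ − A′⁻¹‖_F = ‖A − A′‖_F` on `SU(2)` (`A⁻¹ − A′⁻¹ = A⁻¹(A′ − A)A′⁻¹` with unitary outer factors). [folklore] -/
theorem frobNorm_inv_sub_inv (A A' : SU2) :
    frobNorm (((A⁻¹ : SU2) : Matrix (Fin 2) (Fin 2) ℂ) - ((A'⁻¹ : SU2) : Matrix (Fin 2) (Fin 2) ℂ))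
      = frobNorm ((A : Matrix (Fin 2) (Fin 2) ℂ) - (A' : Matrix (Fin 2) (Fin 2) ℂ)) := by
  have hA : ((A⁻¹ : SU2) : Matrix (Fin 2) (Fin 2) ℂ) * (A : Matrix (Fin 2) (Fin 2) ℂ) = 1 := by
    rw [← Submonoid.coe_mul, inv_mul_cancel, OneMemClass.coe_one]
  have hA' : (A' : Matrix (Fin 2) (Fin 2) ℂ) * ((A'⁻¹ : SU2) : Matrix (Fin 2) (Fin 2) ℂ) = 1 := by
    rw [← Submonoid.coe_mul, mul_inv_cancel, OneMemClass.coe_one]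
  have e : ((A⁻¹ : SU2) : Matrix (Fin 2) (Fin 2) ℂ) - ((A'⁻¹ : SU2) : Matrix (Fin 2) (Fin 2) ℂ)
      = ((A⁻¹ : SU2) : Matrix (Fin 2) (Fin 2) ℂ) * (((A' : Matrix (Fin 2) (Fin 2) ℂ) - (A : Matrix (Fin 2) (Fin 2) ℂ))
          * ((A'⁻¹ : SU2) : Matrix (Fin 2) (Fin 2) ℂ)) := by
    rw [Matrix.sub_mul, Matrix.mul_sub, hA', ← Matrix.mul_assoc, hA, Matrix.one_mul, Matrix.mul_one]
  rw [e, frobNorm_unitary_mul (su2_mem_unitaryGroup _), frobNorm_mul_unitary _ (su2_mem_unitaryGroup _), frobNorm_sub_comm]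

/-- **The commutator holonomy is 2-Lipschitz in each link**:
`‖ABA⁻¹B⁻¹ − A′B′A′⁻¹B′⁻¹‖_F ≤ 2‖A − A′‖_F + 2‖B − B′‖_F` on `SU(2)`. [folklore] -/
theorem frobNorm_comm_sub_comm_le (A B A' B' : SU2) :
    frobNorm (((A * B * A⁻¹ * B⁻¹ : SU2) : Matrix (Fin 2) (Fin 2) ℂ) - ((A' * B' * A'⁻¹ * B'⁻¹ : SU2) : Matrix (Fin 2) (Fin 2) ℂ))
      ≤ 2 * frobNorm ((A : Matrix (Fin 2) (Fin 2) ℂ) - (A' : Matrix (Fin 2) (Fin 2) ℂ))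
        + 2 * frobNorm ((B : Matrix (Fin 2) (Fin 2) ℂ) - (B' : Matrix (Fin 2) (Fin 2) ℂ)) := by
  -- abbreviations for the matrices
  set a : Matrix (Fin 2) (Fin 2) ℂ := (A : Matrix (Fin 2) (Fin 2) ℂ)
  set b : Matrix (Fin 2) (Fin 2) ℂ := (B : Matrix (Fin 2) (Fin 2) ℂ)
  set a' : Matrix (Fin 2) (Fin 2) ℂ := (A' : Matrix (Fin 2) (Fin 2) ℂ)
  set b' : Matrix (Fin 2) (Fin 2) ℂ := (B' : Matrix (Fin 2) (Fin 2) ℂ)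
  set ai : Matrix (Fin 2) (Fin 2) ℂ := ((A⁻¹ : SU2) : Matrix (Fin 2) (Fin 2) ℂ)
  set bi : Matrix (Fin 2) (Fin 2) ℂ := ((B⁻¹ : SU2) : Matrix (Fin 2) (Fin 2) ℂ)
  set ai' : Matrix (Fin 2) (Fin 2) ℂ := ((A'⁻¹ : SU2) : Matrix (Fin 2) (Fin 2) ℂ)
  set bi' : Matrix (Fin 2) (Fin 2) ℂ := ((B'⁻¹ : SU2) : Matrix (Fin 2) (Fin 2) ℂ)
  have hu : ∀ W : SU2, (W : Matrix (Fin 2) (Fin 2) ℂ) ∈ Matrix.unitaryGroup (Fin 2) ℂ := su2_mem_unitaryGroup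
  have hprod : ∀ W W' : SU2, ((W * W' : SU2) : Matrix (Fin 2) (Fin 2) ℂ) ∈ Matrix.unitaryGroup (Fin 2) ℂ := fun W W' => hu (W * W')
  -- telescoping
  have e : ((A * B * A⁻¹ * B⁻¹ : SU2) : Matrix (Fin 2) (Fin 2) ℂ) - ((A' * B' * A'⁻¹ * B'⁻¹ : SU2) : Matrix (Fin 2) (Fin 2) ℂ)
      = (a - a') * (b * ai * bi) + a' * (b - b') * (ai * bi) + a' * b' * (ai - ai') * bi + a' * b' * ai' * (bi - bi') := by
    simp only [Submonoid.coe_mul, a, b, a', b', ai, bi, ai', bi']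
    noncomm_ring
  rw [e]
  -- each of the four terms has Frobenius norm equal to the corresponding link difference
  have t1 : frobNorm ((a - a') * (b * ai * bi)) = frobNorm (a - a') := by
    have : b * ai * bi = ((B * A⁻¹ * B⁻¹ : SU2) : Matrix (Fin 2) (Fin 2) ℂ) := by simp only [Submonoid.coe_mul, b, ai, bi]
    rw [this, frobNorm_mul_unitary _ (hu _)]
  have t2 : frobNorm (a' * (b - b') * (ai * bi)) = frobNorm (b - b') := by
    have : ai * bi = ((A⁻¹ * B⁻¹ : SU2) : Matrix (Fin 2) (Fin 2) ℂ) := by simp only [Submonoid.coe_mul, ai, bi]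
    rw [this, frobNorm_mul_unitary _ (hu _), frobNorm_unitary_mul (hu A')]
  have t3 : frobNorm (a' * b' * (ai - ai') * bi) = frobNorm (a - a') := by
    have h1 : a' * b' = ((A' * B' : SU2) : Matrix (Fin 2) (Fin 2) ℂ) := by simp only [Submonoid.coe_mul, a', b']
    rw [frobNorm_mul_unitary _ (hu B⁻¹), h1, frobNorm_unitary_mul (hu _)]
    exact frobNorm_inv_sub_inv A A'
  have t4 : frobNorm (a' * b' * ai' * (bi - bi')) = frobNorm (b - b') := by
    have h1 : a' * b' * ai' = ((A' * B' * A'⁻¹ : SU2) : Matrix (Fin 2) (Fin 2) ℂ) := by simp only [Submonoid.coe_mul, a', b', ai']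
    rw [h1, frobNorm_unitary_mul (hu _)]
    exact frobNorm_inv_sub_inv B B'
  calc frobNorm ((a - a') * (b * ai * bi) + a' * (b - b') * (ai * bi) + a' * b' * (ai - ai') * bi + a' * b' * ai' * (bi - bi'))
      ≤ frobNorm ((a - a') * (b * ai * bi) + a' * (b - b') * (ai * bi) + a' * b' * (ai - ai') * bi)
          + frobNorm (a' * b' * ai' * (bi - bi')) := frobNorm_add_le _ _
    _ ≤ frobNorm ((a - a') * (b * ai * bi) + a' * (b - b') * (ai * bi)) + frobNorm (a' * b' * (ai - ai') * bi)
          + frobNorm (a' * b' * ai' * (bi - bi')) := by linarith [frobNorm_add_le ((a - a') * (b * ai * bi) + a' * (b - b') * (ai * bi)) (a' * b' * (ai - ai') * bi)]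
    _ ≤ frobNorm ((a - a') * (b * ai * bi)) + frobNorm (a' * (b - b') * (ai * bi)) + frobNorm (a' * b' * (ai - ai') * bi)
          + frobNorm (a' * b' * ai' * (bi - bi')) := by linarith [frobNorm_add_le ((a - a') * (b * ai * bi)) (a' * (b - b') * (ai * bi))]
    _ = 2 * frobNorm (a - a') + 2 * frobNorm (b - b') := by rw [t1, t2, t3, t4]; ring

/-- **The plaquette cost is `4`-Lipschitz in each link**:
`|(2 − Re tr[A,B]) − (2 − Re tr[A′,B′])| ≤ 4 (‖A − A′‖_F + ‖B − B′‖_F)` (`|Re tr X| ≤ 2 ‖X‖_F`). [folklore] -/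
theorem abs_plaquetteCost_sub_le (A B A' B' : SU2) :
    |(2 - (((A * B * A⁻¹ * B⁻¹ : SU2) : Matrix (Fin 2) (Fin 2) ℂ).trace).re)
        - (2 - (((A' * B' * A'⁻¹ * B'⁻¹ : SU2) : Matrix (Fin 2) (Fin 2) ℂ).trace).re)|
      ≤ 4 * (frobNorm ((A : Matrix (Fin 2) (Fin 2) ℂ) - (A' : Matrix (Fin 2) (Fin 2) ℂ))
        + frobNorm ((B : Matrix (Fin 2) (Fin 2) ℂ) - (B' : Matrix (Fin 2) (Fin 2) ℂ))) := by
  have e : (2 - (((A * B * A⁻¹ * B⁻¹ : SU2) : Matrix (Fin 2) (Fin 2) ℂ).trace).re)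
        - (2 - (((A' * B' * A'⁻¹ * B'⁻¹ : SU2) : Matrix (Fin 2) (Fin 2) ℂ).trace).re)
      = -((((A * B * A⁻¹ * B⁻¹ : SU2) : Matrix (Fin 2) (Fin 2) ℂ) - ((A' * B' * A'⁻¹ * B'⁻¹ : SU2) : Matrix (Fin 2) (Fin 2) ℂ)).trace.re) := by
    rw [Matrix.trace_sub, Complex.sub_re]; ring
  rw [e, abs_neg]
  have h1 := abs_re_trace_le_two_mul_frobNorm
    (((A * B * A⁻¹ * B⁻¹ : SU2) : Matrix (Fin 2) (Fin 2) ℂ) - ((A' * B' * A'⁻¹ * B'⁻¹ : SU2) : Matrix (Fin 2) (Fin 2) ℂ))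
  have h2 := frobNorm_comm_sub_comm_le A B A' B'
  linarith

/-! ### §2. The one-site Wilson action: Lipschitz, twist- and gauge-invariant -/

/-- **The one-site Wilson action is link-Lipschitz**: `|S(U) − S(V)| ≤ 24 Σ_e ‖U_e − V_e‖_F`. [folklore] -/
theorem abs_wilsonAction_sub_le (U V : Cfg) :
    |wilsonAction su2Rep U - wilsonAction su2Rep V|
      ≤ 24 * ∑ e, frobNorm ((U e : Matrix (Fin 2) (Fin 2) ℂ) - (V e : Matrix (Fin 2) (Fin 2) ℂ)) := by
  rw [wilsonAction_one_site, wilsonAction_one_site, ← Finset.sum_sub_distrib]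
  set T : ℝ := ∑ e, frobNorm ((U e : Matrix (Fin 2) (Fin 2) ℂ) - (V e : Matrix (Fin 2) (Fin 2) ℂ)) with hT
  have hT0 : 0 ≤ T := Finset.sum_nonneg fun e _ => frobNorm_nonneg _
  have hterm : ∀ p : Plaquette 3 1,
      |(2 - (((U (p.1, p.2.1.1) * U (p.1, p.2.1.2) * (U (p.1, p.2.1.1))⁻¹ * (U (p.1, p.2.1.2))⁻¹ : SU2) :
          Matrix (Fin 2) (Fin 2) ℂ).trace).re)
        - (2 - (((V (p.1, p.2.1.1) * V (p.1, p.2.1.2) * (V (p.1, p.2.1.1))⁻¹ * (V (p.1, p.2.1.2))⁻¹ : SU2) :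
          Matrix (Fin 2) (Fin 2) ℂ).trace).re)| ≤ 8 * T := by
    intro p
    refine (abs_plaquetteCost_sub_le _ _ _ _).trans ?_
    have h1 : frobNorm ((U (p.1, p.2.1.1) : Matrix (Fin 2) (Fin 2) ℂ) - (V (p.1, p.2.1.1) : Matrix (Fin 2) (Fin 2) ℂ)) ≤ T :=
      Finset.single_le_sum (f := fun e => frobNorm ((U e : Matrix (Fin 2) (Fin 2) ℂ) - (V e : Matrix (Fin 2) (Fin 2) ℂ)))
        (fun e _ => frobNorm_nonneg _) (Finset.mem_univ (p.1, p.2.1.1))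
    have h2 : frobNorm ((U (p.1, p.2.1.2) : Matrix (Fin 2) (Fin 2) ℂ) - (V (p.1, p.2.1.2) : Matrix (Fin 2) (Fin 2) ℂ)) ≤ T :=
      Finset.single_le_sum (f := fun e => frobNorm ((U e : Matrix (Fin 2) (Fin 2) ℂ) - (V e : Matrix (Fin 2) (Fin 2) ℂ)))
        (fun e _ => frobNorm_nonneg _) (Finset.mem_univ (p.1, p.2.1.2))
    linarith
  have hP : Fintype.card (Plaquette 3 1) = 3 := by
    rw [show Fintype.card (Plaquette 3 1) = Fintype.card (Site 3 1 × {p : Fin 3 × Fin 3 // p.1 < p.2}) from rfl,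
      Fintype.card_prod, Fintype.card_unique]
    decide
  calc |∑ p : Plaquette 3 1,
        ((2 - (((U (p.1, p.2.1.1) * U (p.1, p.2.1.2) * (U (p.1, p.2.1.1))⁻¹ * (U (p.1, p.2.1.2))⁻¹ : SU2) :
          Matrix (Fin 2) (Fin 2) ℂ).trace).re)
        - (2 - (((V (p.1, p.2.1.1) * V (p.1, p.2.1.2) * (V (p.1, p.2.1.1))⁻¹ * (V (p.1, p.2.1.2))⁻¹ : SU2) :
          Matrix (Fin 2) (Fin 2) ℂ).trace).re))|
      ≤ ∑ p : Plaquette 3 1,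
        |(2 - (((U (p.1, p.2.1.1) * U (p.1, p.2.1.2) * (U (p.1, p.2.1.1))⁻¹ * (U (p.1, p.2.1.2))⁻¹ : SU2) :
          Matrix (Fin 2) (Fin 2) ℂ).trace).re)
        - (2 - (((V (p.1, p.2.1.1) * V (p.1, p.2.1.2) * (V (p.1, p.2.1.1))⁻¹ * (V (p.1, p.2.1.2))⁻¹ : SU2) :
          Matrix (Fin 2) (Fin 2) ℂ).trace).re)| := Finset.abs_sum_le_sum_abs _ _
    _ ≤ ∑ _p : Plaquette 3 1, 8 * T := Finset.sum_le_sum fun p _ => hterm p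
    _ = 24 * T := by rw [Finset.sum_const, Finset.card_univ, hP, nsmul_eq_mul]; ring

/-- The one-site Wilson action is twist-invariant (central factors cancel inside commutators). [cite: tHooft1979] -/
theorem wilsonAction_twist (k : Fin 3) {z : SU2} (hz : z ∈ Subgroup.center SU2) (U : Cfg) :
    wilsonAction su2Rep (twist k z U) = wilsonAction su2Rep U := by
  rw [wilsonAction_one_site, wilsonAction_one_site]
  refine Finset.sum_congr rfl fun p _ => ?_
  have h : ∀ e : Edge 3 1, twist k z U e = z * U e ∨ twist k z U e = U e := fun e => twist_apply_eq_or k z U e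
  rcases h (p.1, p.2.1.1) with h1 | h1 <;> rcases h (p.1, p.2.1.2) with h2 | h2 <;> rw [h1, h2]
  · rw [comm_center_mul_left hz, comm_center_mul_right hz]
  · rw [comm_center_mul_left hz]
  · rw [comm_center_mul_right hz]

end Summit.QuantumFields.YangMills.Theorems.FemtoTransferGap

end
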